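import Mathlib
import Summits.Ventures.PercRepro2.Defs
import Summits.Ventures.PercRepro2.Graph
import Summits.Ventures.PercRepro2.Harris
import Summits.Ventures.PercRepro2.HullDefs
import Summits.Ventures.PercRepro2.LastVertex
import Summits.Ventures.PercRepro2.AvoidSameSide
import Summits.Ventures.PercRepro2.AvoidSameSideDel

/-!
# `NEST ⟸ STEP` for the avoidance same-side sum (mine-1 g8; proofs/MINE1-NEST-INDUCTION.md §3)

With `avoidSameSideDel D` the avoidance same-side sum of the graph with the edges of `D` deleted
(`AvoidSameSideDel.lean`), this file proves

* `avoidSameSideDel_empty_nonneg` — the Harris base `A_D(∅;∅) ≥ 0` (the side signs are increasing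
  in the colouring and have mean zero by the colour swap);
* `avoidSameSideDel_eq_empty_of_subset` — if every edge touching `T` is deleted, avoiding `T` is automatic;
* `avoidSameSideDel_nonneg_of_step` / `nest_of_step` — **NEST follows from STEP**: if for every
  deleted set `D` and `X ⊆ Y` one has `A_D(Y;Y) ≤ A_D(X;Y)` (the red cluster may touch `Y ∖ X` only
  to the advantage of the kernel), then `A_D(X;Y) ≥ 0` for all nested `X, Y`; in particular
  `A(T;T) ≥ 0` (the same-cluster half of the weight-free two-copy BHK family) for the graph itself.
  Proof: induction on the number of non-deleted edges; on the diagonal `X = Y = T` reveal an edge at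
  a vertex of `T` (edge identity + swap) or, if none is left, apply the Harris base.
-/

namespace Summit.Ventures.PercRepro2

namespace Hull

variable {V : Type*} {E : Type*}

/-! ## The Harris base `A_D(∅;∅) ≥ 0` -/

section Base

variable [Fintype E] [DecidableEq E] {ends : E → Sym2 V}

omit [Fintype E] [DecidableEq E] in
/-- `blue` is antitone. -/
lemma blue_antitone {ζ ζ' : Config E} (h : ζ ≤ ζ') : blue ζ' ≤ blue ζ := by
  intro e
  have := h e
  simp only [blue]
  revert this
  cases ζ e <;> cases ζ' e <;> simp

omit [Fintype E] in
/-- The deleted red cluster is monotone in the colouring. -/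
lemma clusterDel_mono (D : Finset E) {ζ ζ' : Config E} (h : ζ ≤ ζ') (l : V) :
    clusterDel ends D ζ l ⊆ clusterDel ends D ζ' l :=
  cluster_mono (closeOn_mono h D) l

omit [Fintype E] in
/-- The deleted blue cluster is antitone in the colouring. -/
lemma clusterDelB_anti (D : Finset E) {ζ ζ' : Config E} (h : ζ ≤ ζ') (l : V) :
    clusterDelB ends D ζ' l ⊆ clusterDelB ends D ζ l :=
  cluster_mono (closeOn_mono (blue_antitone h) D) l

omit [Fintype E] in
/-- The side sign is increasing in the colouring (red grows, blue shrinks). -/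
lemma sideSignDel_mono (D : Finset E) (l o : V) :
    Monotone (fun ζ : Config E => sideSignDel ends D ζ l o) := by
  intro ζ ζ' h
  classical
  have h1 : o ∈ clusterDel ends D ζ l \ clusterDelB ends D ζ l →
      o ∈ clusterDel ends D ζ' l \ clusterDelB ends D ζ' l :=
    fun ⟨ha, hb⟩ => ⟨clusterDel_mono D h l ha, fun hb' => hb (clusterDelB_anti D h l hb')⟩
  have h2 : o ∈ clusterDelB ends D ζ' l \ clusterDel ends D ζ' l →
      o ∈ clusterDelB ends D ζ l \ clusterDel ends D ζ l :=
    fun ⟨ha, hb⟩ => ⟨clusterDelB_anti D h l ha, fun hb' => hb (clusterDel_mono D h l hb')⟩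
  unfold sideSignDel
  by_cases a1 : o ∈ clusterDel ends D ζ l \ clusterDelB ends D ζ l <;>
  by_cases a2 : o ∈ clusterDel ends D ζ' l \ clusterDelB ends D ζ' l <;>
  by_cases b1 : o ∈ clusterDelB ends D ζ l \ clusterDel ends D ζ l <;>
  by_cases b2 : o ∈ clusterDelB ends D ζ' l \ clusterDel ends D ζ' l <;>
  simp only [a1, a2, b1, b2, if_true, if_false] <;> first | omega | exact absurd (h1 a1) a2 | exact absurd (h2 b2) b1

/-- The side sign sums to zero (colour swap). -/
lemma sum_sideSignDel (D : Finset E) (l o : V) :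
    ∑ ζ : Config E, sideSignDel ends D ζ l o = 0 := by
  have hinv : Function.Involutive (blue : Config E → Config E) := fun ζ => blue_blue ζ
  have h := hinv.bijective.sum_comp (fun ζ => sideSignDel ends D ζ l o)
  simp only [sideSignDel_blue, Finset.sum_neg_distrib] at h
  omega

/-- The uniform weight vector. -/
def uniformHalf : E → ℚ := fun _ => 1 / 2

omit [Fintype E] [DecidableEq E] in
/-- The uniform weights are admissible. -/
lemma isProbVec_uniformHalf : IsProbVec (uniformHalf (E := E)) :=
  ⟨fun _ => by norm_num [uniformHalf], fun _ => by norm_num [uniformHalf]⟩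

omit [DecidableEq E] in
/-- Every configuration has the same uniform weight. -/
lemma weight_uniformHalf (ω : Config E) :
    weight (uniformHalf (E := E)) ω = (1 / 2 : ℚ) ^ Fintype.card E := by
  unfold weight uniformHalf edgeFactor
  have h : ∀ e, (if ω e = true then (1 / 2 : ℚ) else 1 - 1 / 2) = 1 / 2 := by
    intro e; cases ω e <;> norm_num
  simp only [h, Finset.prod_const, Finset.card_univ]

/-- Expectation under the uniform weights is the normalised sum. -/
lemma expect_uniformHalf (f : Config E → ℚ) :
    expect (uniformHalf (E := E)) f = (1 / 2 : ℚ) ^ Fintype.card E * ∑ ζ, f ζ := by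
  unfold expect
  rw [Finset.mul_sum]
  refine Finset.sum_congr rfl fun ζ _ => ?_
  rw [weight_uniformHalf]

/-- **Harris base**: with nothing avoided the same-side sum is non-negative. -/
theorem avoidSameSideDel_empty_nonneg (D : Finset E) (l x y : V) :
    0 ≤ avoidSameSideDel ends D l x y ∅ ∅ := by
  classical
  have hA : avoidSameSideDel ends D l x y ∅ ∅ =
      ∑ ζ : Config E, sideSignDel ends D ζ l x * sideSignDel ends D ζ l y := by
    unfold avoidSameSideDel AvoidDel
    simp
  rw [hA]
  -- pass to `ℚ` and apply Harris
  let f : Config E → ℚ := fun ζ => (sideSignDel ends D ζ l x : ℚ)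
  let g : Config E → ℚ := fun ζ => (sideSignDel ends D ζ l y : ℚ)
  have hf : Monotone f := fun ζ ζ' h => Int.cast_le.2 (sideSignDel_mono D l x h)
  have hg : Monotone g := fun ζ ζ' h => Int.cast_le.2 (sideSignDel_mono D l y h)
  have hH := expect_mul_expect_le_expect_mul (isProbVec_uniformHalf (E := E)) hf hg
  have hf0 : expect (uniformHalf (E := E)) f = 0 := by
    rw [expect_uniformHalf]
    have : ∑ ζ : Config E, f ζ = 0 := by
      simp only [f]
      rw [← Int.cast_sum, sum_sideSignDel]
      simp
    rw [this, mul_zero]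
  rw [hf0, zero_mul, expect_uniformHalf] at hH
  have hpos : (0 : ℚ) < (1 / 2 : ℚ) ^ Fintype.card E := by positivity
  have hsum : (0 : ℚ) ≤ ∑ ζ : Config E, (f * g) ζ := by
    by_contra hneg
    have hneg' : ∑ ζ : Config E, (f * g) ζ < 0 := lt_of_not_ge hneg
    have := mul_neg_of_pos_of_neg hpos hneg'
    linarith
  have hcast : (∑ ζ : Config E, (f * g) ζ) =
      ((∑ ζ : Config E, sideSignDel ends D ζ l x * sideSignDel ends D ζ l y : ℤ) : ℚ) := by
    rw [Int.cast_sum]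
    refine Finset.sum_congr rfl fun ζ _ => ?_
    simp [f, g]
  rw [hcast] at hsum
  exact_mod_cast hsum

end Base

/-! ## Avoided vertices with all their edges deleted -/

section Isolated

variable [Fintype E] [DecidableEq E] {ends : E → Sym2 V}

omit [Fintype E] [DecidableEq E] in
/-- If every edge touching `T` is closed in `ω` and `l ∉ T`, the cluster of `l` avoids `T`. -/
lemma disjoint_cluster_of_touches_closed {ω : Config E} {l : V} {T : Set V} (hl : l ∉ T)
    (hT : ∀ e ∈ touches ends T, ω e = false) : Disjoint (cluster ends ω l) T := by
  rw [Set.disjoint_left]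
  intro u hu huT
  have key : u ∈ Tᶜ := by
    refine mem_of_conn_of_closed (ends := ends) (ω := ω) (S := Tᶜ) ?_ hl hu
    intro a ha b hab
    obtain ⟨_, e, he, hends⟩ := openGraph_adj.1 hab
    intro hbT
    have hmem : e ∈ touches ends T := mem_touches_of_ends hends (Or.inr hbT)
    rw [hT e hmem] at he
    exact Bool.false_ne_true he
  exact key huT

omit [Fintype E] in
/-- With every edge touching `T` deleted, the deleted red cluster avoids `T`. -/
lemma disjoint_clusterDel_of_subset {D : Finset E} {ζ : Config E} {l : V} {T : Set V} (hl : l ∉ T)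
    (hT : ∀ e ∈ touches ends T, e ∈ D) : Disjoint (clusterDel ends D ζ l) T :=
  disjoint_cluster_of_touches_closed hl fun e he => by simp [closeOn, hT e he]

omit [Fintype E] in
/-- With every edge touching `T` deleted, the deleted blue cluster avoids `T`. -/
lemma disjoint_clusterDelB_of_subset {D : Finset E} {ζ : Config E} {l : V} {T : Set V} (hl : l ∉ T)
    (hT : ∀ e ∈ touches ends T, e ∈ D) : Disjoint (clusterDelB ends D ζ l) T :=
  disjoint_cluster_of_touches_closed hl fun e he => by simp [closeOn, hT e he]

/-- With every edge touching `T` deleted (and `l ∉ T`), avoiding `T` is automatic. -/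
theorem avoidSameSideDel_eq_empty_of_subset (D : Finset E) (l x y : V) {T : Set V} (hl : l ∉ T)
    (hT : ∀ e ∈ touches ends T, e ∈ D) :
    avoidSameSideDel ends D l x y T T = avoidSameSideDel ends D l x y ∅ ∅ := by
  classical
  unfold avoidSameSideDel
  refine Finset.sum_congr rfl fun ζ _ => ?_
  have h1 : AvoidDel ends D ζ l T T :=
    ⟨disjoint_clusterDel_of_subset hl hT, disjoint_clusterDelB_of_subset hl hT⟩
  have h2 : AvoidDel ends D ζ l ∅ ∅ := ⟨Set.disjoint_empty _, Set.disjoint_empty _⟩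
  rw [if_pos h1, if_pos h2]

/-- If the root is avoided, the sum vanishes. -/
theorem avoidSameSideDel_eq_zero_of_mem (D : Finset E) (l x y : V) {X Y : Set V} (hl : l ∈ X) :
    avoidSameSideDel ends D l x y X Y = 0 := by
  classical
  unfold avoidSameSideDel
  refine Finset.sum_eq_zero fun ζ _ => ?_
  have h : ¬ AvoidDel ends D ζ l X Y := fun hA =>
    Set.disjoint_left.1 hA.1 (mem_cluster_self ends _ l) hl
  rw [if_neg h]

end Isolated

/-! ## NEST from STEP -/

section Main

variable [Fintype E] [DecidableEq E] {ends : E → Sym2 V}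

/-- **NEST follows from STEP.**  If for every deleted edge set `D` and all `X ⊆ Y` one has
`A_D(Y;Y) ≤ A_D(X;Y)` (the red cluster may touch `Y ∖ X` only to the advantage of the kernel),
then `A_D(X;Y) ≥ 0` for all `D` and all `X ⊆ Y`.  Induction on the number of non-deleted edges:
the diagonal case `X = Y = T` reveals an edge at a vertex of `T` (the edge identity + the swap),
or, if no such edge is left, is the Harris base. -/
theorem avoidSameSideDel_nonneg_of_step (l x y : V)
    (hstep : ∀ (D : Finset E) (X Y : Set V), X ⊆ Y →
      avoidSameSideDel ends D l x y Y Y ≤ avoidSameSideDel ends D l x y X Y) :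
    ∀ (D : Finset E) (X Y : Set V), X ⊆ Y → 0 ≤ avoidSameSideDel ends D l x y X Y := by
  classical
  -- the diagonal case by strong induction on the number of active edges
  have hdiag : ∀ n : ℕ, ∀ D : Finset E, (Finset.univ \ D).card = n →
      ∀ T : Set V, 0 ≤ avoidSameSideDel ends D l x y T T := by
    intro n
    induction n using Nat.strong_induction_on with
    | _ n ih =>
      intro D hD T
      by_cases hl : l ∈ T
      · rw [avoidSameSideDel_eq_zero_of_mem D l x y hl]
      by_cases hex : ∃ e, e ∉ D ∧ ∃ z ∈ T, ∃ w, ends e = s(z, w)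
      · obtain ⟨e, heD, z, hz, w, hends⟩ := hex
        have hcard : (Finset.univ \ insert e D).card < n := by
          rw [← hD, Finset.sdiff_insert]
          exact Finset.card_erase_lt_of_mem (by simp [heD])
        have hIH := ih _ hcard (insert e D) rfl (T ∪ {w})
        have hst := hstep (insert e D) T (T ∪ {w}) Set.subset_union_left
        have hid := two_mul_avoidSameSideDel (ends := ends) D l x y T T hends hz hz heD
        rw [avoidSameSideDel_swap ends (insert e D) l x y (T ∪ {w}) T] at hid
        omega
      · have hT : ∀ e ∈ touches ends T, e ∈ D := by
          intro e he
          by_contra heD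
          exact hex ⟨e, heD, he⟩
        rw [avoidSameSideDel_eq_empty_of_subset D l x y hl hT]
        exact avoidSameSideDel_empty_nonneg D l x y
  intro D X Y hXY
  exact le_trans (hdiag _ D rfl Y) (hstep D X Y hXY)

/-- **Corollary**: `STEP` for the deleted-edge family implies `2′NEST` and hence `A(T;T) ≥ 0`
(the same-cluster half of the weight-free two-copy BHK family) for the graph itself. -/
theorem nest_of_step (l x y : V)
    (hstep : ∀ (D : Finset E) (X Y : Set V), X ⊆ Y →
      avoidSameSideDel ends D l x y Y Y ≤ avoidSameSideDel ends D l x y X Y) :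
    ∀ (X Y : Set V), (X ⊆ Y ∨ Y ⊆ X) → 0 ≤ avoidSameSide ends l x y X Y := by
  intro X Y hXY
  rw [← avoidSameSideDel_empty]
  rcases hXY with h | h
  · exact avoidSameSideDel_nonneg_of_step l x y hstep ∅ X Y h
  · rw [avoidSameSideDel_swap]
    exact avoidSameSideDel_nonneg_of_step l x y hstep ∅ Y X h

end Main

end Hull

end Summit.Ventures.PercRepro2
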